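import Mathlib
import HarnessLib
import Summits.ValiantsHypothesis.ValiantsHypothesis.Theorems.MonotoneRestorationMonotoneRestorationQPLinearWidthGluedDvorak
import Summits.ValiantsHypothesis.ValiantsHypothesis.Theorems.MonotoneRestorationOrbitRestorationQPValueOrbitDivisionAlgebra
import Literature.Computability.AlgebraicComplexity.DawarWilsenach2025Proofs
import Literature.ModelTheory.FiniteModelTheory.DawarWilsenach2025Thm72

/-!
# Route MonotoneRestoration, crux `MonotoneRestorationQP` (stmt-15886), line `linear-width`, GAP 1 — NO UNIVERSAL
# INDIVIDUALISING MULTIPLIER, UNCONDITIONALLY (helper, def-free)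

The saturation template for GAP 1 (`…LinearWidthSaturation.lean`): a matrix-symmetric multiplier `D` such that `D·h` is
hom-determined for EVERY matrix-symmetric `h`; to divide it out one needs `D(a) ≠ 0` at a `Sym_n`-fixed base point.  With the
weighted Dvořák theorem at glued points (`…LinearWidthGluedDvorak.lean`) and the Cai–Fürer–Immerman pairs of Dawar–Wilsenach
Thm 7.2 (PROVED in the tree, `DawarWilsenach2025_thm72_family`) this is now refuted in the kernel WITHOUT any hypothesis:

* `eval_scale`, `eval_smul_of_isHomogeneous` — bookkeeping (`q(t·v) = t^j q(v)` for homogeneous `q`);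
* `perPoly_separates_glued_pencil` — the permanent separates the glued pencil `a + t·1_X`, `a + t·1_Y` through EVERY base point
  `a = α·I + β·(J − I)` whenever the bipartite graphs `X, Y` have different numbers of perfect matchings (homogeneity moves the
  known separation at `a = 0` to some parameter `t₀` on any pencil);
* `no_universal_multiplier` — **for every `k` there is an order `m = O(k)` at which every `D ∈ ℂ[x_ij : i,j < m]` such that `D`
  and `D·per_m` are hom-determined below treewidth `k` VANISHES AT EVERY `Sym_m`-FIXED BASE POINT.**  In particular no multiplier
  that individualises all matrix-symmetric families (the saturator's defining property) admits Strassen division anywhere on the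
  invariant locus, at any polylogarithmic (indeed linear) width — the template behind `stub_degreeLifting`'s docstring remark is
  closed.  (For multipliers serving only `VP` families the statement stays relative to a glued-separating `VP` family, i.e. to the
  H-side; `GluedDvorak.multiplier_vanishes_of_ckEquiv_pencil`.)

Honest label: a no-go made unconditional; no stub closed; VP ≠ VNP untouched.
[cite: DawarWilsenach2025, Thm 7.2, §7.1 (p. 19); Dvorak2010, Thm 6]
-/

-- `Summit.ValiantsHypothesis.ValiantsHypothesis.…` is the tree's mandated namespace (Sub = Summit).
set_option linter.dupNamespace false

noncomputable section

open scoped Classical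

namespace Summit.ValiantsHypothesis.ValiantsHypothesis.Theorems

namespace GluedDvorak

open MvPolynomial Finset
open Literature.Computability.AlgebraicComplexity
open Literature.ModelTheory.FiniteModelTheory
open MonotoneRestorationQPLinearWidth

variable {m : ℕ}

/-- Evaluating the scaled polynomial `q(t·x)` at `v` is evaluating `q` at `t·v`. [folklore] -/
theorem eval_scale (t : ℂ) (v : Fin m × Fin m → ℂ) (q : MvPolynomial (Fin m × Fin m) ℂ) :
    eval v (aeval (fun x : Fin m × Fin m => C t * X x) q) = eval (fun x => t * v x) q := by
  induction q using MvPolynomial.induction_on with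
  | C c => simp only [algHom_C, algebraMap_eq, eval_C]
  | add p q hp hq => simp only [map_add, hp, hq]
  | mul_X p i hp => simp only [map_mul, hp, aeval_X, eval_C, eval_X]

/-- `q(t·v) = t^j · q(v)` for `q` homogeneous of degree `j`. [folklore] -/
theorem eval_smul_of_isHomogeneous {q : MvPolynomial (Fin m × Fin m) ℂ} {j : ℕ} (hq : q.IsHomogeneous j) (t : ℂ)
    (v : Fin m × Fin m → ℂ) : eval (fun x => t * v x) q = t ^ j * eval v q := by
  rw [← eval_scale, ValueOrbitDivision.scale_of_isHomogeneous t hq, map_mul, eval_C]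

/-- **The permanent separates every glued pencil through a CFI-matching pair.**  If the bipartite graphs `X, Y` on `Fin m` have
different numbers of perfect matchings, then for every base point `a = α·I + β·(J − I)` some parameter `t₀` has
`per(a + t₀·1_X) ≠ per(a + t₀·1_Y)`. [cite: DawarWilsenach2025, §7.1 (p. 19)] -/
theorem perPoly_separates_glued_pencil {X Y : SimpleGraph (Fin m)} {s t s' t' : Set (Fin m)}
    (hX : X.IsBipartiteWith s t) (hst : s ∪ t = Set.univ) (hY : Y.IsBipartiteWith s' t') (hst' : s' ∪ t' = Set.univ)
    (hne : Nat.card {M : X.Subgraph // M.IsPerfectMatching} ≠ Nat.card {M : Y.Subgraph // M.IsPerfectMatching})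
    (α β : ℂ) :
    ∃ t₀ : ℂ,
      eval (fun ij : Fin m × Fin m => (if ij.1 = ij.2 then α else β) +
        t₀ * Set.indicator {ij : Fin m × Fin m | X.Adj ij.1 ij.2} (1 : Fin m × Fin m → ℂ) ij) (perPoly (Fin m) ℂ) ≠
      eval (fun ij : Fin m × Fin m => (if ij.1 = ij.2 then α else β) +
        t₀ * Set.indicator {ij : Fin m × Fin m | Y.Adj ij.1 ij.2} (1 : Fin m × Fin m → ℂ) ij) (perPoly (Fin m) ℂ) := by
  -- the `0/1` points in `ite` form
  have hindX : ∀ ij : Fin m × Fin m,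
      Set.indicator {ij : Fin m × Fin m | X.Adj ij.1 ij.2} (1 : Fin m × Fin m → ℂ) ij = if X.Adj ij.1 ij.2 then 1 else 0 := by
    intro ij; by_cases h : X.Adj ij.1 ij.2 <;> simp [Set.indicator, h]
  have hindY : ∀ ij : Fin m × Fin m,
      Set.indicator {ij : Fin m × Fin m | Y.Adj ij.1 ij.2} (1 : Fin m × Fin m → ℂ) ij = if Y.Adj ij.1 ij.2 then 1 else 0 := by
    intro ij; by_cases h : Y.Adj ij.1 ij.2 <;> simp [Set.indicator, h]
  -- separation at the origin of the pencil parameter `a = 0` (Dawar–Wilsenach p. 19)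
  have hsep0 : eval (Set.indicator {ij : Fin m × Fin m | X.Adj ij.1 ij.2} (1 : Fin m × Fin m → ℂ)) (perPoly (Fin m) ℂ) ≠
      eval (Set.indicator {ij : Fin m × Fin m | Y.Adj ij.1 ij.2} (1 : Fin m × Fin m → ℂ)) (perPoly (Fin m) ℂ) := by
    have h := eval_perPoly_adj_ne_of_card_perfectMatchings_ne hX hst hY hst' ℂ hne
    have e1 : (Set.indicator {ij : Fin m × Fin m | X.Adj ij.1 ij.2} (1 : Fin m × Fin m → ℂ)) =
        fun ij => if X.Adj ij.1 ij.2 then 1 else 0 := funext hindX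
    have e2 : (Set.indicator {ij : Fin m × Fin m | Y.Adj ij.1 ij.2} (1 : Fin m × Fin m → ℂ)) =
        fun ij => if Y.Adj ij.1 ij.2 then 1 else 0 := funext hindY
    rw [e1, e2]
    exact h
  by_contra hall
  push Not at hall
  apply hsep0
  -- abbreviations
  set a : Fin m × Fin m → ℂ := fun ij => if ij.1 = ij.2 then α else β with ha
  set NX : Fin m × Fin m → ℂ := Set.indicator {ij : Fin m × Fin m | X.Adj ij.1 ij.2} (1 : Fin m × Fin m → ℂ) with hNX
  set NY : Fin m × Fin m → ℂ := Set.indicator {ij : Fin m × Fin m | Y.Adj ij.1 ij.2} (1 : Fin m × Fin m → ℂ) with hNY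
  have hhom := perPoly_isHomogeneous (n := Fin m) (k := ℂ)
  -- by homogeneity, the reversed pencils `N + s·a` agree at every `s ≠ 0`
  have hrev : ∀ s : ℂ, s ≠ 0 →
      eval (fun x => NX x + s * a x) (perPoly (Fin m) ℂ) = eval (fun x => NY x + s * a x) (perPoly (Fin m) ℂ) := by
    intro s hs
    have hXs : (fun x => NX x + s * a x) = fun x => s * (a x + s⁻¹ * NX x) := by
      funext x; field_simp; ring
    have hYs : (fun x => NY x + s * a x) = fun x => s * (a x + s⁻¹ * NY x) := by
      funext x; field_simp; ring
    rw [hXs, hYs, eval_smul_of_isHomogeneous hhom, eval_smul_of_isHomogeneous hhom, hall s⁻¹]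
  -- as one-variable polynomials they agree on the infinite set `{s ≠ 0}`, hence everywhere, in particular at `s = 0`
  set PX : Polynomial ℂ :=
    aeval (fun x : Fin m × Fin m => Polynomial.C (NX x) + Polynomial.C (a x) * Polynomial.X) (perPoly (Fin m) ℂ) with hPX
  set PY : Polynomial ℂ :=
    aeval (fun x : Fin m × Fin m => Polynomial.C (NY x) + Polynomial.C (a x) * Polynomial.X) (perPoly (Fin m) ℂ) with hPY
  have hPXY : PX = PY := by
    refine Polynomial.eq_of_infinite_eval_eq PX PY ((Set.finite_singleton (0 : ℂ)).infinite_compl.mono ?_)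
    intro s hs
    have hs' : s ≠ 0 := fun h => hs (by simp [h])
    show Polynomial.eval s PX = Polynomial.eval s PY
    rw [hPX, hPY, MultiplierNoGo.eval_linePoly, MultiplierNoGo.eval_linePoly]
    exact hrev s hs'
  have h0 := congrArg (Polynomial.eval (0 : ℂ)) hPXY
  rw [hPX, hPY, MultiplierNoGo.eval_linePoly, MultiplierNoGo.eval_linePoly] at h0
  simpa only [zero_mul, add_zero] using h0

/-- **NO UNIVERSAL INDIVIDUALISING MULTIPLIER (unconditional).**  For every `k` there is an order `m ≤ c·k + c` at which every
polynomial `D` such that `D` and `D·per_m` are hom-determined below treewidth `k` vanishes at every `Sym_m`-fixed base point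
`α·I + β·(J − I)`. [cite: DawarWilsenach2025, Thm 7.2; Dvorak2010, Thm 6] -/
theorem no_universal_multiplier :
    ∃ c : ℕ, ∀ k : ℕ, ∃ m : ℕ, m ≤ c * k + c ∧
      ∀ (α β : ℂ) (D : MvPolynomial (Fin m × Fin m) ℂ),
        (∀ A B, HomIndist m k A B → eval A D = eval B D) →
        (∀ A B, HomIndist m k A B → eval A (D * perPoly (Fin m) ℂ) = eval B (D * perPoly (Fin m) ℂ)) →
        eval (fun ij : Fin m × Fin m => if ij.1 = ij.2 then α else β) D = 0 := by
  obtain ⟨c, hc⟩ := CFIMatching.DawarWilsenach2025_thm72_family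
  refine ⟨c, fun k => ?_⟩
  obtain ⟨m, hm, X, Y, ⟨s, t, hX, hst⟩, ⟨s', t', hY, hst'⟩, hXY, hne⟩ := hc k
  refine ⟨m, hm, fun α β D hD hDh => ?_⟩
  exact multiplier_vanishes_of_ckEquiv_pencil hXY α β hD hDh (perPoly_separates_glued_pencil hX hst hY hst' hne α β)

end GluedDvorak

end Summit.ValiantsHypothesis.ValiantsHypothesis.Theorems

end
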